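import Summits.Ventures.LatticeQCDFlow.Scaling.IdealStarLawFreeKLogK
import Summits.Ventures.LatticeQCDFlow.Scaling.LumpedStarCollectorFloor
import Summits.Ventures.LatticeQCDFlow.Scaling.HomStarStationaryLumping
import Summits.Ventures.LatticeQCDFlow.Scaling.HomStarFullCollectorFloor
import Summits.Ventures.LatticeQCDFlow.Scaling.RegenerationTagDecay

/-!
HONEST FRAMING: exact (Metropolis-corrected) sampling algorithms for lattice gauge theory; figures
of merit are autocorrelation/cost numbers at stated couplings and volumes; no continuum-physics
claim.

# LumpedStarLawFreeLogFloor — THE STEP LAW OF CHAPTER AD IS TWO-SIDED INCLUDING THE LOGARITHM AT CONSTANT PERSISTENCE, FOR EVERY CONTENT LAW: FOR X5's STEP CHAIN WITH `W ≡ 1`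
# (EVERY SWAP ACCEPTED) AND ANY `μ_0` WITH SOME `μ_0(u) ≤ ½`, `t_mix^{steps}(1/4) ≥ (K/(σ(1−σ)) − 1)·log((K+σ)/max{260, 8√(2(K+1))})` — AGAINST AD4's
# `O((K/((1−σ)σp̄))·log(K/(σp̄ε)))` THE SAME UNIT `K/(σ(1−σ))` AND THE LOGARITHM (lean-2 GEN-45, ours)

Venture-side (OURS).  Cell `lqcd-flow` (pub-lqcd), unit `pub-lqcd-lean-2-g45`, 2026-08-31.  Chapter AE, file 16 — file 12 (the law-free `½·log K` for the idealised hot-only star in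
the unit `K/(t(1−t))`) carried to X5's lumped step chain `S = σA + (1−σ)B` through AD8 ∕ AD9's lumping: the idealised star with hub list `κ = id` (one entry per cold level), hot-only
weights and exact redraws IS chapter U's homogeneous star with `μ_k = μ_0` for all `k`, whose pooled law from `y_u ≡ u` is `δ_{x₀}Sⁿ` with `x₀` the composition crowded at `u`
(`homStar_pushforward_lawAt` with `w_0 = 1`, so no idle part), and whose pooled equilibrium is X5's `π_S` (AD15).  File 12's witness is a COMPOSITION event, so its two mass bounds
are mass bounds for `δ_{x₀}Sⁿ` and `π_S`; X5 ∕ X7 ∕ LPW 4.9 discharge stationarity and convergence as in file 2.  The auxiliary scheme, list, kernels and lumping map are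
constructed inside the proof: the hypotheses are the lumped star's objects only.

* **`lumpedStar_step_tvDist_ge_lawFree`** (`‖δ_{x₀}Sⁿ − π_S‖_TV ≥ ½` while `(1−σ(1−σ)/K)ⁿ(K+σ) ≥ max{260, 8√(2(K+1))}`), **`lumpedStar_step_mixingTime_ge_lawFree`**
  (**`t_mix^{steps}(1/4) ≥ (K/(σ(1−σ)) − 1)·log((K+σ)/max{260, 8√(2(K+1))})`**); and the other side by the same lumping — every state is a `Λ`-image (its `π_S`-mass is a
  positive fibre sum), a lumping never increases total variation (file 15), GEN-27's ceiling for the idealised star with `κ = id`: **`lumpedStar_step_worstTvDist_le_lawFree`**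
  (`d_S(n) ≤ ((K+1)/σ)(1 − σ(1−σ)/(2K))ⁿ`), **`lumpedStar_step_two_sided_lawFree`** (`… ≤ t_mix^{steps}(1/4) ≤ ⌈(2K/(σ(1−σ)))·log(4(K+1)/σ)⌉`, explicit constants, no chain
  hypothesis).

Reading (no numerics implied): with AD4 (`t_mix^{steps}(ε₀) = O((K/((1−σ)σp̄))·log(K/(σp̄ε₀)))`, `p̄ = ½` at `W ≡ 1`) — or with this file's own explicit ceiling — the lumped star's
step law at constant persistence is `Θ((K/(σ(1−σ)))·log K)` from both sides for EVERY content law with two or more contents — the sharp step logarithm of OPEN-MATH item 1 (i) (b′) is attained, not merely an upper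
bound.  NOT CLAIMED: persistence `W ≢ 1` (file 4 gives the logarithm there only on symmetric content types with `≥ K+1` contents; the toy says it survives).  Literature grade (cell rule):
OWN assembly; nothing cited as a fact; no new bib keys.
-/

noncomputable section

open Finset Function
open Literature.Probability.MarkovChains

namespace Summit.Ventures.LatticeQCDFlow.Scaling

section LawFreeLumped
variable {X : Type*} [Fintype X] [DecidableEq X] {S : Type*} [Fintype S] [DecidableEq S]
variable {hub : X → S} {comp : X → S → ℕ} {K : ℕ} {ν W : S → ℝ} {σ : ℝ} {acc : S → S → ℝ} {Kh : (S → ℕ) → S → S → ℝ}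
variable {Ast Bst Sst : X → X → ℝ} {g : (S → ℕ) → ℝ} {πS : X → ℝ} {Z : ℝ}

/-- **THE LAW-FREE FLOOR ON THE DISTANCE FOR THE LUMPED STEP CHAIN AT CONSTANT PERSISTENCE:** `W ≡ 1`, `0 < σ < 1`, `K ≥ 2`, `μ_0 = ν > 0` with `ν(u) ≤ ½`; with
`s = (1−σ(1−σ)/K)ⁿ(K+σ) ≥ 260` and `s ≥ 8√(2(K+1))`: from the composition crowded at `u`, **`‖δ_{x₀}Sⁿ − π_S‖_TV ≥ ½`**. [ours] -/
theorem lumpedStar_step_tvDist_ge_lawFree [Nonempty X] (hinj : ∀ x x', hub x = hub x' → comp x = comp x' → x = x')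
    (hsurj : ∀ (z : S) (N : S → ℕ), ∑ v, N v = K + 1 → N z ≠ 0 → ∃ x, hub x = z ∧ comp x = N) (hhub : ∀ x, comp x (hub x) ≠ 0)
    (hsum : ∀ x, ∑ v, comp x v = K + 1) (hK : 2 ≤ K) (hWone : ∀ v, W v = 1) (hacc : ∀ h v, acc h v = min 1 (W h / W v)) (hν : ∀ v, 0 < ν v) (hν1 : ∑ v, ν v = 1)
    (hσ0 : 0 < σ) (hσ1 : σ < 1)
    (hKoff : ∀ N h v, h ≠ v → Kh N h v = if N h = 0 then 0 else (N v : ℝ) / K * acc h v) (hKdiag : ∀ N h, Kh N h h = 1 - ∑ v ∈ univ.erase h, Kh N h v)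
    (hA : ∀ x x', Ast x x' = if comp x' = comp x then Kh (comp x) (hub x) (hub x') else 0)
    (hB : ∀ x x', Bst x x' = ν (hub x') * (if comp x' + Pi.single (hub x) 1 = comp x + Pi.single (hub x') 1 then 1 else 0))
    (hS : ∀ x x', Sst x x' = σ * Ast x x' + (1 - σ) * Bst x x')
    (hg : ∀ N, g N = ∏ v, (ν v * W v) ^ (N v) / ((N v).factorial : ℝ))
    (hZ : Z = ∑ x, g (comp x) * ((comp x (hub x) : ℝ) / W (hub x))) (hπS : ∀ x, πS x = g (comp x) * ((comp x (hub x) : ℝ) / W (hub x)) / Z)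
    (u : S) (hu : ν u ≤ 1 / 2) {x₀ : X} (hx₀h : hub x₀ = u) (hx₀c : comp x₀ = fun v => if v = u then K + 1 else 0)
    (n : ℕ) (hs64 : 260 ≤ (1 - σ * (1 - σ) / K) ^ n * ((K : ℝ) + σ)) (hs : 8 * Real.sqrt (2 * ((K : ℝ) + 1)) ≤ (1 - σ * (1 - σ) / K) ^ n * ((K : ℝ) + σ)) :
    1 / 2 ≤ tvDist (lawAt Sst (Pi.single x₀ 1) n) πS := by
  classical
  -- the auxiliary homogeneous scheme: one entry per cold level, hot-only weights, exact hot redraws, idle cold kernels, all levels of law `ν`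
  set κ : Fin K → Fin K := id with hκ
  set μ : Fin (K + 1) → S → ℝ := fun _ => ν with hμdef
  set w : Fin (K + 1) → ℝ := fun k => if k = 0 then (1 : ℝ) else 0 with hwdef
  set M : Fin (K + 1) → S → S → ℝ := fun k a b => if k = 0 then ν b else (if b = a then (1 : ℝ) else 0) with hMdef
  have hm : 1 ≤ K := by omega
  have hμ : ∀ k x, 0 < μ k x := fun _ x => hν x
  have hμsum : ∀ k, ∑ a, μ k a = 1 := fun _ => hν1
  have hhom : ∀ i : Fin K, μ i.succ = μ 1 := fun _ => rfl
  have hw0 : ∀ k, 0 ≤ w k := fun k => by rw [hwdef]; simp only; split_ifs <;> norm_num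
  have hw00 : 0 < w 0 := by rw [hwdef]; simp
  have hw1 : ∑ k, w k = 1 := by rw [hwdef]; simp
  have hM0 : ∀ a b, M 0 a b = μ 0 b := fun a b => by rw [hMdef]; simp [hμdef]
  have hidle : ∀ i : Fin K, ∀ a b, M i.succ a b = if b = a then 1 else 0 := fun i a b => by rw [hMdef]; simp [Fin.succ_ne_zero]
  have hMrs : ∀ k, IsRowStochastic (M k) := by
    intro k
    refine Fin.cases ?_ (fun i => ?_) k
    · exact ⟨fun a b => by rw [hM0]; exact (hμ 0 b).le, fun a => by simp_rw [hM0]; exact hμsum 0⟩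
    · refine ⟨fun a b => by rw [hidle]; split_ifs <;> norm_num, fun a => ?_⟩
      simp_rw [hidle]; rw [Finset.sum_ite_eq' univ a]; simp
  have hunif : ∀ i : Fin K, (univ.filter fun r : Fin K => κ r = i).card = 1 := fun i => by
    rw [hκ]; simp only [id]; rw [Finset.filter_eq' univ i]; simp
  have hmc : K = 1 * K := (one_mul K).symm
  have hWdef : ∀ v, W v = μ 1 v / μ 0 v := fun v => by rw [hWone, hμdef]; simp only; rw [div_self (hν v).ne']
  -- the lumping map
  have hcount : ∀ y : Fin (K + 1) → S, ∑ v, (univ.filter fun k : Fin (K + 1) => y k = v).card = K + 1 := by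
    intro y
    rw [← Finset.card_biUnion (fun v _ v' _ hvv' => Finset.disjoint_filter.mpr fun k _ h1 h2 => hvv' (h1.symm.trans h2))]
    rw [show (univ : Finset S).biUnion (fun v => univ.filter fun k : Fin (K + 1) => y k = v) = univ by
      ext k; simp]
    rw [card_univ, Fintype.card_fin]
  have hex : ∀ y : Fin (K + 1) → S, ∃ x, hub x = y 0 ∧ comp x = fun v => (univ.filter fun k : Fin (K + 1) => y k = v).card := fun y =>
    hsurj (y 0) _ (hcount y) (show (univ.filter fun k : Fin (K + 1) => y k = y 0).card ≠ 0 from Finset.card_ne_zero.mpr ⟨0, mem_filter.mpr ⟨mem_univ _, rfl⟩⟩)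
  choose Λ hΛ using hex
  have hΛh : ∀ y, hub (Λ y) = y 0 := fun y => (hΛ y).1
  have hΛc : ∀ y v, comp (Λ y) v = (univ.filter fun k : Fin (K + 1) => y k = v).card := fun y v => by rw [(hΛ y).2]
  have hΛu : Λ (fun _ : Fin (K + 1) => u) = x₀ := by
    refine hinj _ _ (by rw [hΛh, hx₀h]) ?_
    rw [(hΛ _).2, hx₀c]; funext v; by_cases hv : v = u
    · subst hv; simp
    · rw [if_neg hv]; simp [Ne.symm hv]
  -- the step chain is the lazy lumped kernel with `t = σ`, `w_0 = 1`
  have hSl : ∀ x x', Sst x x' = σ * Ast x x' + (1 - σ) * (w 0 * Bst x x' + (1 - w 0) * (if x = x' then 1 else 0)) := by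
    intro x x'; rw [hS, hwdef]; simp
  have hB' : ∀ x x', Bst x x' = μ 0 (hub x') * (if comp x' + Pi.single (hub x) 1 = comp x + Pi.single (hub x') 1 then 1 else 0) := fun x x' => by rw [hB, hμdef]
  have hacc' : ∀ a b, acc a b = min 1 (μ 0 b * μ 1 a / (μ 0 a * μ 1 b)) := by
    intro a b; rw [hacc, hWone, hWone, hμdef]; simp only
    rw [div_one, show ν b * ν a / (ν a * ν b) = 1 from by rw [mul_comm]; exact div_self (mul_ne_zero (hν a).ne' (hν b).ne')]
  -- the push-forward identity and the identification of `π_S`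
  have hpush := homStar_pushforward_lawAt κ hm hμ hhom hw1 hM0 hidle hunif hacc' hKoff hKdiag hA hB' hSl hΛh hΛc hinj (Pi.single (fun _ : Fin (K + 1) => u) 1) n
  have hδ : (fun x => ∑ y' ∈ univ.filter (fun y' => Λ y' = x), (Pi.single (fun _ : Fin (K + 1) => u) (1 : ℝ) : (Fin (K + 1) → S) → ℝ) y') = Pi.single x₀ 1 := by
    rw [← hΛu]; exact funext fun x => lumping_pushforward_single (fun _ => u) x
  rw [hδ] at hpush
  have hπ : ∀ x, πS x = ∑ y ∈ univ.filter (fun y => Λ y = x), tensorFun μ y := fun x =>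
    homStar_piS_eq_pushforward κ hm hμ hμsum hhom hw0 hw00 hw1 hσ0 hσ1 hM0 hidle hunif hWdef hinj hsum hsurj hhub (by omega) hacc hKoff hKdiag hA hB' hSl hg hZ hπS hΛh hΛc x
  -- file 12's mass bounds on the composition event
  set lam : ℝ := Real.sqrt (2 * ((K : ℝ) + 1)) with hlamdef
  have hlam : 0 < lam := Real.sqrt_pos.mpr (by positivity)
  have hlam2 : lam ^ 2 = 2 * ((K : ℝ) + 1) := Real.sq_sqrt (by positivity)
  have hdef := idealStar_count_deficit_le_unit κ hm hσ0 hσ1 hK hν hν1 hMrs (fun a b => by rw [hM0]) hunif hmc u hu n hlam hs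
  have hexc := tensor_count_excess_le (K := K) hν hν1 u hlam
  -- translate: the event is a composition event
  set L : (Fin (K + 1) → S) → ℝ := lawAt (fun y z => σ * ptGraphSwap μ (fun r : Fin K => (((0 : Fin (K + 1)), (κ r).succ) : Fin (K + 1) × Fin (K + 1)))
      (fun _ : Fin K => Equiv.refl S) y z + (1 - σ) * prodKernel w M y z) (Pi.single (fun _ : Fin (K + 1) => u) 1) n with hLdef
  have hpush' : ∀ x, ∑ y' ∈ univ.filter (fun y' => Λ y' = x), L y' = lawAt Sst (Pi.single x₀ 1) n x := fun x => congrFun hpush x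
  have hπ' : ∀ x, ∑ y ∈ univ.filter (fun y => Λ y = x), tensorFun μ y = πS x := fun x => (hπ x).symm
  have hcard : ∀ z : Fin (K + 1) → S, (∑ k, (if z k = u then (1 : ℝ) else 0)) = (comp (Λ z) u : ℝ) := by
    intro z; rw [hΛc, Finset.card_filter]; push_cast; rfl
  have hPrs : IsRowStochastic (fun y z : Fin (K + 1) → S => σ * ptGraphSwap μ (fun r : Fin K => (((0 : Fin (K + 1)), (κ r).succ) : Fin (K + 1) × Fin (K + 1))) (fun _ : Fin K => Equiv.refl S) y z
          + (1 - σ) * prodKernel w M y z) := by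
    have h1 := ptGraphSwap_isRowStochastic (e := fun r : Fin K => (((0 : Fin (K + 1)), (κ r).succ) : Fin (K + 1) × Fin (K + 1))) (φ := fun _ => Equiv.refl S) hμ
    have h2 := prodKernel_isRowStochastic (P := M) (w := w) hw0 hw1 hMrs
    refine ⟨fun y z => add_nonneg (mul_nonneg hσ0.le (h1.1 y z)) (mul_nonneg (by linarith) (h2.1 y z)), fun y => ?_⟩
    simp only
    rw [sum_add_distrib, ← mul_sum, ← mul_sum, h1.2 y, h2.2 y]; ring
  have htot : ∑ z, L z = 1 := by rw [hLdef, sum_lawAt hPrs, Finset.sum_pi_single']; simp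
  have hmassL : ∑ x ∈ univ.filter (fun x => ((K : ℝ) + 1) * ν u + lam ≤ (comp x u : ℝ)), lawAt Sst (Pi.single x₀ 1) n x
      ≥ 1 - ((64 * ((1 - σ * (1 - σ) / K) ^ n * ((K : ℝ) + σ)) + 36) / ((1 - σ * (1 - σ) / K) ^ n * ((K : ℝ) + σ)) ^ 2 + ((K : ℝ) + 1) * (ν u * (1 - ν u)) / lam ^ 2) := by
    -- `Σ_{x ∈ A} (Λ_*L)(x) = Σ_z L(z) 𝟙_A(Λ z) = 1 − Σ_z L(z) 𝟙{deficit}`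
    have key := pushforward_sum_mul (Λ := Λ) L (fun x => if ((K : ℝ) + 1) * ν u + lam ≤ (comp x u : ℝ) then (1 : ℝ) else 0)
    simp only [hpush'] at key
    have e1 : ∑ x ∈ univ.filter (fun x => ((K : ℝ) + 1) * ν u + lam ≤ (comp x u : ℝ)), lawAt Sst (Pi.single x₀ 1) n x
        = ∑ z, L z * (if ((K : ℝ) + 1) * ν u + lam ≤ (comp (Λ z) u : ℝ) then (1 : ℝ) else 0) := by
      rw [key, Finset.sum_filter]
      exact sum_congr rfl fun x _ => by split_ifs <;> simp
    have hsplit := Finset.sum_filter_add_sum_filter_not univ (fun z : Fin (K + 1) → S => ((K : ℝ) + 1) * ν u + lam ≤ ∑ k, (if z k = u then (1 : ℝ) else 0)) L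
    rw [htot] at hsplit
    have hAc : univ.filter (fun z : Fin (K + 1) → S => ∑ k, (if z k = u then (1 : ℝ) else 0) < ((K : ℝ) + 1) * ν u + lam)
        = univ.filter (fun z : Fin (K + 1) → S => ¬ (((K : ℝ) + 1) * ν u + lam ≤ ∑ k, (if z k = u then (1 : ℝ) else 0))) := by simp only [not_le]
    have hdef' : ∑ z ∈ univ.filter (fun z : Fin (K + 1) → S => ¬ (((K : ℝ) + 1) * ν u + lam ≤ ∑ k, (if z k = u then (1 : ℝ) else 0))), L z
        ≤ (64 * ((1 - σ * (1 - σ) / K) ^ n * ((K : ℝ) + σ)) + 36) / ((1 - σ * (1 - σ) / K) ^ n * ((K : ℝ) + σ)) ^ 2 + ((K : ℝ) + 1) * (ν u * (1 - ν u)) / lam ^ 2 := by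
      rw [← hAc]; exact hdef
    have e2 : ∑ z, L z * (if ((K : ℝ) + 1) * ν u + lam ≤ (comp (Λ z) u : ℝ) then (1 : ℝ) else 0)
        = ∑ z ∈ univ.filter (fun z : Fin (K + 1) → S => ((K : ℝ) + 1) * ν u + lam ≤ ∑ k, (if z k = u then (1 : ℝ) else 0)), L z := by
      rw [Finset.sum_filter]; refine sum_congr rfl fun z _ => ?_
      rw [← hcard z]; split_ifs <;> simp
    rw [e1, e2]; linarith
  have hmassπ : ∑ x ∈ univ.filter (fun x => ((K : ℝ) + 1) * ν u + lam ≤ (comp x u : ℝ)), πS x ≤ ((K : ℝ) + 1) * (ν u * (1 - ν u)) / lam ^ 2 := by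
    have key := pushforward_sum_mul (Λ := Λ) (tensorFun μ) (fun x => if ((K : ℝ) + 1) * ν u + lam ≤ (comp x u : ℝ) then (1 : ℝ) else 0)
    simp only [hπ'] at key
    have e1 : ∑ x ∈ univ.filter (fun x => ((K : ℝ) + 1) * ν u + lam ≤ (comp x u : ℝ)), πS x
        = ∑ z, tensorFun μ z * (if ((K : ℝ) + 1) * ν u + lam ≤ (comp (Λ z) u : ℝ) then (1 : ℝ) else 0) := by
      rw [key, Finset.sum_filter]
      exact sum_congr rfl fun x _ => by split_ifs <;> simp
    have e2 : ∑ z, tensorFun μ z * (if ((K : ℝ) + 1) * ν u + lam ≤ (comp (Λ z) u : ℝ) then (1 : ℝ) else 0)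
        = ∑ z ∈ univ.filter (fun z : Fin (K + 1) → S => ((K : ℝ) + 1) * ν u + lam ≤ ∑ k, (if z k = u then (1 : ℝ) else 0)), tensorFun μ z := by
      rw [Finset.sum_filter]; refine sum_congr rfl fun z _ => ?_
      rw [← hcard z]; split_ifs <;> simp
    rw [e1, e2]; exact hexc
  -- the two Chebyshev terms and the survival term
  have hνu : ν u * (1 - ν u) ≤ 1 / 4 := by nlinarith
  have hcheb : ((K : ℝ) + 1) * (ν u * (1 - ν u)) / lam ^ 2 ≤ 1 / 8 := by rw [hlam2, div_le_iff₀ (by positivity)]; nlinarith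
  set s : ℝ := (1 - σ * (1 - σ) / K) ^ n * ((K : ℝ) + σ) with hsdef
  have h4s : (64 * s + 36) / s ^ 2 ≤ 1 / 4 := by rw [div_le_div_iff₀ (by positivity) (by norm_num)]; nlinarith
  -- masses and the event form of total variation
  have hW' : ∀ v, 0 < W v := fun v => by rw [hWone]; norm_num
  have hπpos := lumpedStar_piS_pos hhub hW' hν hg hZ hπS
  have hπ1 := lumpedStar_piS_sum hhub hW' hν hg hZ hπS
  have hA0 : ∀ x x', 0 ≤ Ast x x' := starStep_swap_nonneg hW' hacc (by omega) hsum hKoff hKdiag hA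
  have hA1 : ∀ x, ∑ x', Ast x x' = 1 := starStep_swap_rowsum hinj hsurj hhub hsum hKoff hKdiag hA
  have hB0 : ∀ x x', 0 ≤ Bst x x' := fun x x' => by rw [hB]; exact mul_nonneg (hν _).le (by split_ifs <;> norm_num)
  have hB1 : ∀ x, ∑ x', Bst x x' = 1 := starStep_redraw_rowsum hinj hsurj hhub hsum hν1 hB
  have hSrs : IsRowStochastic Sst := by
    refine ⟨fun x y => by rw [hS]; exact add_nonneg (mul_nonneg hσ0.le (hA0 x y)) (mul_nonneg (by linarith) (hB0 x y)), fun x => ?_⟩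
    simp_rw [hS]; rw [sum_add_distrib, ← mul_sum, ← mul_sum, hA1, hB1]; ring
  have hl1 : ∑ x, lawAt Sst (Pi.single x₀ (1 : ℝ)) n x = ∑ x, πS x := by rw [sum_lawAt hSrs, Finset.sum_pi_single', if_pos (mem_univ _), hπ1]
  have htv := sub_sum_le_tvDist hl1 (univ.filter (fun x => ((K : ℝ) + 1) * ν u + lam ≤ (comp x u : ℝ)))
  linarith

/-- **THE LAW-FREE `½·log K` FLOOR FOR THE LUMPED STEP CHAIN, as printed:** `W ≡ 1`, `0 < σ < 1`, `K ≥ 2`, `μ_0 = ν > 0` with some `ν(u) ≤ ½`: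
**`t_mix^{steps}(1/4) ≥ (K/(σ(1−σ)) − 1)·log((K+σ)/max{260, 8√(2(K+1))})`** — with AD4's ceiling the step law is `Θ((K/(σ(1−σ)))·log K)` from both sides at constant persistence.
[ours] -/
theorem lumpedStar_step_mixingTime_ge_lawFree [Nonempty X] (hinj : ∀ x x', hub x = hub x' → comp x = comp x' → x = x')
    (hsurj : ∀ (z : S) (N : S → ℕ), ∑ v, N v = K + 1 → N z ≠ 0 → ∃ x, hub x = z ∧ comp x = N) (hhub : ∀ x, comp x (hub x) ≠ 0)
    (hsum : ∀ x, ∑ v, comp x v = K + 1) (hK : 2 ≤ K) (hWone : ∀ v, W v = 1) (hacc : ∀ h v, acc h v = min 1 (W h / W v)) (hν : ∀ v, 0 < ν v) (hν1 : ∑ v, ν v = 1)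
    (hσ0 : 0 < σ) (hσ1 : σ < 1)
    (hKoff : ∀ N h v, h ≠ v → Kh N h v = if N h = 0 then 0 else (N v : ℝ) / K * acc h v) (hKdiag : ∀ N h, Kh N h h = 1 - ∑ v ∈ univ.erase h, Kh N h v)
    (hA : ∀ x x', Ast x x' = if comp x' = comp x then Kh (comp x) (hub x) (hub x') else 0)
    (hB : ∀ x x', Bst x x' = ν (hub x') * (if comp x' + Pi.single (hub x) 1 = comp x + Pi.single (hub x') 1 then 1 else 0))
    (hS : ∀ x x', Sst x x' = σ * Ast x x' + (1 - σ) * Bst x x')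
    (hg : ∀ N, g N = ∏ v, (ν v * W v) ^ (N v) / ((N v).factorial : ℝ))
    (hZ : Z = ∑ x, g (comp x) * ((comp x (hub x) : ℝ) / W (hub x))) (hπS : ∀ x, πS x = g (comp x) * ((comp x (hub x) : ℝ) / W (hub x)) / Z)
    (u : S) (hu : ν u ≤ 1 / 2) :
    ((K : ℝ) / (σ * (1 - σ)) - 1) * Real.log (((K : ℝ) + σ) / max 260 (8 * Real.sqrt (2 * ((K : ℝ) + 1)))) ≤ (mixingTime Sst πS (1 / 4) : ℝ) := by
  classical
  obtain ⟨x₀, hx₀h, hx₀c⟩ := hsurj u (fun v => if v = u then K + 1 else 0) (by rw [Finset.sum_ite_eq' univ u]; simp) (by simp)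
  set C : ℝ := max 260 (8 * Real.sqrt (2 * ((K : ℝ) + 1))) with hC
  have hKpos : (0 : ℝ) < K := by exact_mod_cast (by omega : 0 < K)
  have hK2 : (2 : ℝ) ≤ K := by exact_mod_cast hK
  have hCpos : 0 < C := lt_of_lt_of_le (by norm_num) (le_max_left _ _)
  have h1σ : 0 < 1 - σ := by linarith
  have hθ0 : 0 < σ * (1 - σ) / K := div_pos (mul_pos hσ0 h1σ) hKpos
  have hθ1 : σ * (1 - σ) / K < 1 := by rw [div_lt_one hKpos]; nlinarith
  have hKσ : (0 : ℝ) < (K : ℝ) + σ := by linarith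
  -- stationarity and convergence (X5, X7, LPW 4.9) as in file 2
  have hW' : ∀ v, 0 < W v := fun v => by rw [hWone]; norm_num
  have hπpos := lumpedStar_piS_pos hhub hW' hν hg hZ hπS
  have hπ1 := lumpedStar_piS_sum hhub hW' hν hg hZ hπS
  have hA0 : ∀ x x', 0 ≤ Ast x x' := starStep_swap_nonneg hW' hacc (by omega) hsum hKoff hKdiag hA
  have hA1 : ∀ x, ∑ x', Ast x x' = 1 := starStep_swap_rowsum hinj hsurj hhub hsum hKoff hKdiag hA
  have hB0 : ∀ x x', 0 ≤ Bst x x' := fun x x' => by rw [hB]; exact mul_nonneg (hν _).le (by split_ifs <;> norm_num)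
  have hB1 : ∀ x, ∑ x', Bst x x' = 1 := starStep_redraw_rowsum hinj hsurj hhub hsum hν1 hB
  have hArev : ∀ x x', πS x * Ast x x' = πS x' * Ast x' x := starStep_swap_reversible hinj hhub hW' hacc hKoff hA hπS
  have hBrev : ∀ x x', πS x * Bst x x' = πS x' * Bst x' x := starStep_redraw_reversible hhub hW' hg hπS hB
  have hSrs : IsRowStochastic Sst := by
    refine ⟨fun x y => by rw [hS]; exact add_nonneg (mul_nonneg hσ0.le (hA0 x y)) (mul_nonneg (by linarith) (hB0 x y)), fun x => ?_⟩
    simp_rw [hS]; rw [sum_add_distrib, ← mul_sum, ← mul_sum, hA1, hB1]; ring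
  have hst : IsStationary πS Sst := by
    intro y
    calc ∑ x, πS x * Sst x y = ∑ x, (σ * (πS y * Ast y x) + (1 - σ) * (πS y * Bst y x)) :=
          sum_congr rfl fun x _ => by rw [hS, ← hArev, ← hBrev]; ring
      _ = σ * (πS y * ∑ x, Ast y x) + (1 - σ) * (πS y * ∑ x, Bst y x) := by rw [sum_add_distrib, ← mul_sum, ← mul_sum, ← mul_sum, ← mul_sum]
      _ = πS y := by rw [hA1, hB1]; ring
  have hirr := lumpedStar_step_irreducible hsurj hhub hW' hacc (by omega) hsum hKoff hKdiag hν hσ0 hσ1 hA hB hS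
  have hap : IsAperiodic Sst := isAperiodic_of_diag_pos fun x => by
    rw [hS]
    have hBxx : Bst x x = ν (hub x) := by rw [hB, if_pos rfl, mul_one]
    have : 0 < (1 - σ) * Bst x x := by rw [hBxx]; exact mul_pos (by linarith) (hν _)
    have := mul_nonneg hσ0.le (hA0 x x)
    linarith
  have hmix : ∃ t₀, worstTvDist Sst πS t₀ ≤ 1 / 4 := exists_worstTvDist_le hSrs hirr hap hst (fun x => (hπpos x).le) hπ1 (by norm_num)
  -- the floor
  by_contra h
  push Not at h
  set n := mixingTime Sst πS (1 / 4) with hn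
  have hconv : (K : ℝ) / (σ * (1 - σ)) - 1 = (1 - σ * (1 - σ) / K) / (σ * (1 - σ) / K) := by field_simp
  rw [hconv] at h
  have hge : C ≤ (1 - σ * (1 - σ) / K) ^ n * ((K : ℝ) + σ) := by
    have h1θ : 0 < 1 - σ * (1 - σ) / K := by linarith
    have hle := mul_le_mul_of_nonneg_left h.le (div_pos hθ0 h1θ).le
    have e0 : σ * (1 - σ) / K / (1 - σ * (1 - σ) / K) * ((1 - σ * (1 - σ) / K) / (σ * (1 - σ) / K)) = 1 := by
      rw [div_mul_div_comm, mul_comm (σ * (1 - σ) / K) (1 - σ * (1 - σ) / K)]; exact div_self (mul_ne_zero h1θ.ne' hθ0.ne')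
    have e1 : σ * (1 - σ) / K / (1 - σ * (1 - σ) / K) * ((1 - σ * (1 - σ) / K) / (σ * (1 - σ) / K) * Real.log (((K : ℝ) + σ) / C)) = Real.log (((K : ℝ) + σ) / C) := by
      rw [← mul_assoc, e0, one_mul]
    have e2 : σ * (1 - σ) / K / (1 - σ * (1 - σ) / K) * (n : ℝ) = n * (σ * (1 - σ) / K) / (1 - σ * (1 - σ) / K) := by ring
    rw [e1, e2] at hle
    calc C = ((K : ℝ) + σ) * Real.exp (-Real.log (((K : ℝ) + σ) / C)) := by rw [Real.exp_neg, Real.exp_log (div_pos hKσ hCpos)]; field_simp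
      _ ≤ ((K : ℝ) + σ) * Real.exp (-(n * (σ * (1 - σ) / K) / (1 - σ * (1 - σ) / K))) := mul_le_mul_of_nonneg_left (Real.exp_le_exp.mpr (neg_le_neg hle)) hKσ.le
      _ ≤ ((K : ℝ) + σ) * (1 - σ * (1 - σ) / K) ^ n := mul_le_mul_of_nonneg_left (one_sub_pow_ge_exp hθ1 n) hKσ.le
      _ = (1 - σ * (1 - σ) / K) ^ n * ((K : ℝ) + σ) := mul_comm _ _
  have hs64 : 260 ≤ (1 - σ * (1 - σ) / K) ^ n * ((K : ℝ) + σ) := le_trans (le_max_left _ _) hge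
  have hs8 : 8 * Real.sqrt (2 * ((K : ℝ) + 1)) ≤ (1 - σ * (1 - σ) / K) ^ n * ((K : ℝ) + σ) := le_trans (le_max_right _ _) hge
  have hfloor := lumpedStar_step_tvDist_ge_lawFree hinj hsurj hhub hsum hK hWone hacc hν hν1 hσ0 hσ1 hKoff hKdiag hA hB hS hg hZ hπS u hu hx₀h hx₀c n hs64 hs8
  have hd : worstTvDist Sst πS n ≤ 1 / 4 := by
    obtain ⟨t₀, ht₀⟩ := hmix
    exact worstTvDist_le_of_mixingTime_le hSrs hst ht₀ le_rfl
  have hw := tvDist_single_le_worstTvDist Sst πS n x₀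
  linarith

/-- **THE OTHER SIDE BY THE SAME LUMPING:** `W ≡ 1`, `0 < σ < 1`, `K ≥ 1`, `ν > 0` of unit mass: **`d_S(n) ≤ ((K+1)/σ)·(1 − σ(1−σ)/(2K))ⁿ`** — every state is `Λy` (its `π_S`-mass is a
positive fibre sum of `⊗ν`), `δ_{Λy}Sⁿ = Λ_*(δ_yPⁿ)` (AD9 with `w_0 = 1`), a lumping never increases total variation, and GEN-27's ceiling for the idealised star with `κ = id`. [ours] -/
theorem lumpedStar_step_worstTvDist_le_lawFree [Nonempty X] (hinj : ∀ x x', hub x = hub x' → comp x = comp x' → x = x')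
    (hsurj : ∀ (z : S) (N : S → ℕ), ∑ v, N v = K + 1 → N z ≠ 0 → ∃ x, hub x = z ∧ comp x = N) (hhub : ∀ x, comp x (hub x) ≠ 0)
    (hsum : ∀ x, ∑ v, comp x v = K + 1) (hK : 1 ≤ K) (hWone : ∀ v, W v = 1) (hacc : ∀ h v, acc h v = min 1 (W h / W v)) (hν : ∀ v, 0 < ν v) (hν1 : ∑ v, ν v = 1)
    (hσ0 : 0 < σ) (hσ1 : σ < 1)
    (hKoff : ∀ N h v, h ≠ v → Kh N h v = if N h = 0 then 0 else (N v : ℝ) / K * acc h v) (hKdiag : ∀ N h, Kh N h h = 1 - ∑ v ∈ univ.erase h, Kh N h v)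
    (hA : ∀ x x', Ast x x' = if comp x' = comp x then Kh (comp x) (hub x) (hub x') else 0)
    (hB : ∀ x x', Bst x x' = ν (hub x') * (if comp x' + Pi.single (hub x) 1 = comp x + Pi.single (hub x') 1 then 1 else 0))
    (hS : ∀ x x', Sst x x' = σ * Ast x x' + (1 - σ) * Bst x x')
    (hg : ∀ N, g N = ∏ v, (ν v * W v) ^ (N v) / ((N v).factorial : ℝ))
    (hZ : Z = ∑ x, g (comp x) * ((comp x (hub x) : ℝ) / W (hub x))) (hπS : ∀ x, πS x = g (comp x) * ((comp x (hub x) : ℝ) / W (hub x)) / Z) (n : ℕ) :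
    worstTvDist Sst πS n ≤ ((K : ℝ) + 1) / σ * (1 - σ * (1 - σ) / (2 * K)) ^ n := by
  classical
  set κ : Fin K → Fin K := id with hκ
  set μ : Fin (K + 1) → S → ℝ := fun _ => ν with hμdef
  set w : Fin (K + 1) → ℝ := fun k => if k = 0 then (1 : ℝ) else 0 with hwdef
  set M : Fin (K + 1) → S → S → ℝ := fun k a b => if k = 0 then ν b else (if b = a then (1 : ℝ) else 0) with hMdef
  have hμ : ∀ k x, 0 < μ k x := fun _ x => hν x
  have hμsum : ∀ k, ∑ a, μ k a = 1 := fun _ => hν1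
  have hhom : ∀ i : Fin K, μ i.succ = μ 1 := fun _ => rfl
  have hw0 : ∀ k, 0 ≤ w k := fun k => by rw [hwdef]; simp only; split_ifs <;> norm_num
  have hw00 : 0 < w 0 := by rw [hwdef]; simp
  have hw1 : ∑ k, w k = 1 := by rw [hwdef]; simp
  have hM0 : ∀ a b, M 0 a b = μ 0 b := fun a b => by rw [hMdef]; simp [hμdef]
  have hM0' : ∀ a b, M 0 a b = ν b := fun a b => by rw [hMdef]; simp
  have hidle : ∀ i : Fin K, ∀ a b, M i.succ a b = if b = a then 1 else 0 := fun i a b => by rw [hMdef]; simp [Fin.succ_ne_zero]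
  have hMrs : ∀ k, IsRowStochastic (M k) := by
    intro k
    refine Fin.cases ?_ (fun i => ?_) k
    · exact ⟨fun a b => by rw [hM0]; exact (hμ 0 b).le, fun a => by simp_rw [hM0]; exact hμsum 0⟩
    · refine ⟨fun a b => by rw [hidle]; split_ifs <;> norm_num, fun a => ?_⟩
      simp_rw [hidle]; rw [Finset.sum_ite_eq' univ a]; simp
  have hunif : ∀ i : Fin K, (univ.filter fun r : Fin K => κ r = i).card = 1 := fun i => by
    rw [hκ]; simp only [id]; rw [Finset.filter_eq' univ i]; simp
  have hWdef : ∀ v, W v = μ 1 v / μ 0 v := fun v => by rw [hWone, hμdef]; simp only; rw [div_self (hν v).ne']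
  have hcount : ∀ y : Fin (K + 1) → S, ∑ v, (univ.filter fun k : Fin (K + 1) => y k = v).card = K + 1 := by
    intro y
    rw [← Finset.card_biUnion (fun v _ v' _ hvv' => Finset.disjoint_filter.mpr fun k _ h1 h2 => hvv' (h1.symm.trans h2))]
    rw [show (univ : Finset S).biUnion (fun v => univ.filter fun k : Fin (K + 1) => y k = v) = univ by
      ext k; simp]
    rw [card_univ, Fintype.card_fin]
  have hex : ∀ y : Fin (K + 1) → S, ∃ x, hub x = y 0 ∧ comp x = fun v => (univ.filter fun k : Fin (K + 1) => y k = v).card := fun y =>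
    hsurj (y 0) _ (hcount y) (show (univ.filter fun k : Fin (K + 1) => y k = y 0).card ≠ 0 from Finset.card_ne_zero.mpr ⟨0, mem_filter.mpr ⟨mem_univ _, rfl⟩⟩)
  choose Λ hΛ using hex
  have hΛh : ∀ y, hub (Λ y) = y 0 := fun y => (hΛ y).1
  have hΛc : ∀ y v, comp (Λ y) v = (univ.filter fun k : Fin (K + 1) => y k = v).card := fun y v => by rw [(hΛ y).2]
  have hSl : ∀ x x', Sst x x' = σ * Ast x x' + (1 - σ) * (w 0 * Bst x x' + (1 - w 0) * (if x = x' then 1 else 0)) := by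
    intro x x'; rw [hS, hwdef]; simp
  have hB' : ∀ x x', Bst x x' = μ 0 (hub x') * (if comp x' + Pi.single (hub x) 1 = comp x + Pi.single (hub x') 1 then 1 else 0) := fun x x' => by rw [hB, hμdef]
  have hacc' : ∀ a b, acc a b = min 1 (μ 0 b * μ 1 a / (μ 0 a * μ 1 b)) := by
    intro a b; rw [hacc, hWone, hWone, hμdef]; simp only
    rw [div_one, show ν b * ν a / (ν a * ν b) = 1 from by rw [mul_comm]; exact div_self (mul_ne_zero (hν a).ne' (hν b).ne')]
  have hπ : ∀ x, πS x = ∑ y ∈ univ.filter (fun y => Λ y = x), tensorFun μ y := fun x =>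
    homStar_piS_eq_pushforward κ (le_refl _ |>.trans hK) hμ hμsum hhom hw0 hw00 hw1 hσ0 hσ1 hM0 hidle hunif hWdef hinj hsum hsurj hhub hK hacc hKoff hKdiag hA hB' hSl hg hZ hπS hΛh hΛc x
  have hW' : ∀ v, 0 < W v := fun v => by rw [hWone]; norm_num
  have hπpos := lumpedStar_piS_pos hhub hW' hν hg hZ hπS
  have hsurjΛ : ∀ x, ∃ y, Λ y = x := by
    intro x
    by_contra hx
    push Not at hx
    have h0 : πS x = 0 := by
      rw [hπ x]; exact Finset.sum_eq_zero fun y hy => (hx y (mem_filter.mp hy).2).elim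
    exact (lt_irrefl (0 : ℝ)) (h0 ▸ hπpos x)
  -- GEN-27's ceiling for the idealised star with `κ = id` (`m = K`, `c = 1`)
  have hc : ∀ p : Fin K, 1 ≤ (univ.filter (fun r : Fin K => κ r = p)).card := fun p => (hunif p).ge
  have hceil := idealStar_worstTvDist_le κ hK hσ0 hσ1 hν hν1 hMrs hM0' (le_refl 1) hc hK n
  have hKpos : (0 : ℝ) < K := by exact_mod_cast (by omega : 0 < K)
  have hrate : (1 : ℝ) - σ * (1 - σ) * (1 : ℕ) / (2 * (K : ℕ)) = 1 - σ * (1 - σ) / (2 * K) := by push_cast; rw [mul_one]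
  rw [hrate] at hceil
  have hnonneg : 0 ≤ ((K : ℝ) + 1) / σ * (1 - σ * (1 - σ) / (2 * K)) ^ n := by
    refine mul_nonneg (by positivity) (pow_nonneg ?_ n)
    have hK1r : (1 : ℝ) ≤ K := by exact_mod_cast hK
    have h14 : σ * (1 - σ) ≤ 1 / 4 := by nlinarith [sq_nonneg (σ - 1 / 2)]
    have : σ * (1 - σ) / (2 * K) ≤ 1 := by
      rw [div_le_one (by positivity)]; linarith
    linarith
  refine Real.iSup_le (fun x => ?_) hnonneg
  obtain ⟨y, hy⟩ := hsurjΛ x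
  have hpush := homStar_pushforward_lawAt κ hK hμ hhom hw1 hM0 hidle hunif hacc' hKoff hKdiag hA hB' hSl hΛh hΛc hinj (Pi.single y 1) n
  have hδ : (fun x' => ∑ y' ∈ univ.filter (fun y' => Λ y' = x'), (Pi.single y (1 : ℝ) : (Fin (K + 1) → S) → ℝ) y') = Pi.single x 1 := by
    rw [← hy]; exact funext fun x' => lumping_pushforward_single y x'
  rw [hδ] at hpush
  rw [← hpush, funext hπ]
  refine (tvDist_pushforward_le Λ _ _).trans ((tvDist_single_le_worstTvDist _ _ n y).trans ((hceil).trans (le_of_eq ?_)))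
  ring

/-- **THE TWO-SIDED `K·log K` LAW FOR X5's STEP CHAIN AT CONSTANT PERSISTENCE, EVERY CONTENT LAW, EXPLICIT CONSTANTS, UNCONDITIONALLY IN THE CHAIN:** `W ≡ 1`, `0 < σ < 1`,
`K ≥ 2`, `ν > 0` with some `ν(u) ≤ ½`:
**`(K/(σ(1−σ)) − 1)·log((K+σ)/max{260, 8√(2(K+1))}) ≤ t_mix^{steps}(1/4) ≤ ⌈(2K/(σ(1−σ)))·log(4(K+1)/σ)⌉`**. [ours] -/
theorem lumpedStar_step_two_sided_lawFree [Nonempty X] (hinj : ∀ x x', hub x = hub x' → comp x = comp x' → x = x')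
    (hsurj : ∀ (z : S) (N : S → ℕ), ∑ v, N v = K + 1 → N z ≠ 0 → ∃ x, hub x = z ∧ comp x = N) (hhub : ∀ x, comp x (hub x) ≠ 0)
    (hsum : ∀ x, ∑ v, comp x v = K + 1) (hK : 2 ≤ K) (hWone : ∀ v, W v = 1) (hacc : ∀ h v, acc h v = min 1 (W h / W v)) (hν : ∀ v, 0 < ν v) (hν1 : ∑ v, ν v = 1)
    (hσ0 : 0 < σ) (hσ1 : σ < 1)
    (hKoff : ∀ N h v, h ≠ v → Kh N h v = if N h = 0 then 0 else (N v : ℝ) / K * acc h v) (hKdiag : ∀ N h, Kh N h h = 1 - ∑ v ∈ univ.erase h, Kh N h v)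
    (hA : ∀ x x', Ast x x' = if comp x' = comp x then Kh (comp x) (hub x) (hub x') else 0)
    (hB : ∀ x x', Bst x x' = ν (hub x') * (if comp x' + Pi.single (hub x) 1 = comp x + Pi.single (hub x') 1 then 1 else 0))
    (hS : ∀ x x', Sst x x' = σ * Ast x x' + (1 - σ) * Bst x x')
    (hg : ∀ N, g N = ∏ v, (ν v * W v) ^ (N v) / ((N v).factorial : ℝ))
    (hZ : Z = ∑ x, g (comp x) * ((comp x (hub x) : ℝ) / W (hub x))) (hπS : ∀ x, πS x = g (comp x) * ((comp x (hub x) : ℝ) / W (hub x)) / Z)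
    (u : S) (hu : ν u ≤ 1 / 2) :
    ((K : ℝ) / (σ * (1 - σ)) - 1) * Real.log (((K : ℝ) + σ) / max 260 (8 * Real.sqrt (2 * ((K : ℝ) + 1)))) ≤ (mixingTime Sst πS (1 / 4) : ℝ) ∧
    mixingTime Sst πS (1 / 4) ≤ ⌈2 * (K : ℝ) / (σ * (1 - σ)) * Real.log (((K : ℝ) + 1) / (σ * (1 / 4)))⌉₊ := by
  refine ⟨lumpedStar_step_mixingTime_ge_lawFree hinj hsurj hhub hsum hK hWone hacc hν hν1 hσ0 hσ1 hKoff hKdiag hA hB hS hg hZ hπS u hu,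
    mixingTime_le _ _ ((lumpedStar_step_worstTvDist_le_lawFree hinj hsurj hhub hsum (by omega) hWone hacc hν hν1 hσ0 hσ1 hKoff hKdiag hA hB hS hg hZ hπS _).trans ?_)⟩
  have hKpos : (0 : ℝ) < K := by exact_mod_cast (by omega : 0 < K)
  have h1σ : 0 < 1 - σ := by linarith
  have ha0 : 0 < σ * (1 - σ) / (2 * K) := by positivity
  have ha1 : σ * (1 - σ) / (2 * K) ≤ 1 := by
    have hK1r : (2 : ℝ) ≤ K := by exact_mod_cast hK
    have h14 : σ * (1 - σ) ≤ 1 / 4 := by nlinarith [sq_nonneg (σ - 1 / 2)]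
    rw [div_le_one (by positivity)]; linarith
  refine geom_le_of_ge_log ha0 ha1 (by positivity) (by norm_num) (le_trans (le_of_eq ?_) (Nat.le_ceil _))
  rw [show ((K : ℝ) + 1) / σ / (1 / 4) = ((K : ℝ) + 1) / (σ * (1 / 4)) by rw [div_div]]
  congr 1
  field_simp

end LawFreeLumped

end Summit.Ventures.LatticeQCDFlow.Scaling

end
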